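import Mathlib
import HarnessLib
import Summits.CriticalPhenomena.PercolationContinuityZ3.Theses.PercTreeValue
import Summits.CriticalPhenomena.PercolationContinuityZ3.Theses.PercAnnulusCrossing
import Literature.Probability.Percolation.BlockResampling
import Literature.Probability.Percolation.TwoPointFunction

/-!
# Strategist s4 census sketch for crux stmt-CriticalPhenomena-7799 (`PercTreeValue.TetrahedronHarrisGap`)

Typed signatures quoted in `STRATEGY-CENSUS.md` (s4).  Nothing here is a line; no `sorry`.
Notation: `a_r = (r,r,0)`, `b_r = (r,0,r)`, `c_r = (0,r,r)`, `k = ⌊r/8⌋`,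
`R_r = [−r,2r]² × [−2r,3k]`, `R'_r = R_r + B(2k−1)` (roof `5k−1`), `U_r = {x₂ ≥ r − 3k}`,
`W_r = {0 ↔ a_r in R_r} ∩ {b_r ↔ c_r in U_r}`, `f = P(0 ↔ b_r | ω off the collar pairs)`.
-/

noncomputable section

open MeasureTheory Filter Set
open Literature.Probability.Percolation Literature.Probability.LatticeModels

namespace Summit.CriticalPhenomena.PercolationContinuityZ3.Cruxes.TetrahedronHarrisGap.CensusS4

/-- The lower box `R_r` of the live line (7798's S5' box). -/
def lowerBox (r : ℕ) : Set (Site 3) :=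
  {x : Site 3 | -(r : ℤ) ≤ x 0 ∧ x 0 ≤ 2 * (r : ℤ) ∧ -(r : ℤ) ≤ x 1 ∧ x 1 ≤ 2 * (r : ℤ) ∧
    -(2 * (r : ℤ)) ≤ x 2 ∧ x 2 ≤ 3 * ((r : ℤ) / 8)}

/-- The enlarged box `R'_r` (collar outer boundary). -/
def outerBox (r : ℕ) : Set (Site 3) :=
  {x : Site 3 | -(r : ℤ) - (2 * ((r : ℤ) / 8) - 1) ≤ x 0 ∧ x 0 ≤ 2 * (r : ℤ) + (2 * ((r : ℤ) / 8) - 1) ∧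
    -(r : ℤ) - (2 * ((r : ℤ) / 8) - 1) ≤ x 1 ∧ x 1 ≤ 2 * (r : ℤ) + (2 * ((r : ℤ) / 8) - 1) ∧
    -(2 * (r : ℤ)) - (2 * ((r : ℤ) / 8) - 1) ≤ x 2 ∧ x 2 ≤ 5 * ((r : ℤ) / 8) - 1}

/-- The upper region `U_r`. -/
def upperRegion (r : ℕ) : Set (Site 3) := {x : Site 3 | (r : ℤ) - 3 * ((r : ℤ) / 8) ≤ x 2}

/-- `W_r`: the two restricted connections of the ORIGINAL pair (off-collar event). -/
def W (r : ℕ) : Set (BondConfig (Site 3)) :=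
  openConnIn (lowerBox r) (0 : Site 3) ![(r : ℤ), (r : ℤ), 0] ∩
    openConnIn (upperRegion r) (![(r : ℤ), 0, (r : ℤ)] : Site 3) ![0, (r : ℤ), (r : ℤ)]

/-- The critical measure on `ℤ³`. -/
abbrev P : Measure (BondConfig (Site 3)) := bondPercolation (zdGraph 3) (criticalProbI 3)

/-- **S⁺5 / D6 `CollarNonDegeneracy`** (strengthened residue of the live line rev 7, typed): for every finite
block `K` of pairs whose support is exactly the collar `R'_r ∖ R_r`, on a `κ`-fraction of `W_r` the collar-conditional
gluing probability `f = P(0 ↔ b_r | ω off K)` is TWO-SIDEDLY non-degenerate, `κ ≤ f ≤ 1 − κ`.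
Lower half ⊇ RestrictedGluing (world-neutral); upper half = "non-gluing of the two η-determined traces across a
collar of thickness ≍ r/4, for most η" (blocking-type, continuity-strength; supplied uniformly in η by a closed
shell, i.e. by X_B, in the lead's composition).  With BoxRestriction it implies the crux without X_B
(`D6_glue`). -/
def CollarNonDegeneracy : Prop :=
  ∃ κ : ℝ, 0 < κ ∧ ∃ r₀ : ℕ, ∀ r : ℕ, r₀ ≤ r → ∀ K : Finset (Sym2 (Site 3)),
    (↑K : Set (Sym2 (Site 3))) = (outerBox r \ lowerBox r).sym2 →
      κ * P.real (W r) ≤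
        P.real (W r ∩ {ω | κ ≤ blockCondProb (zdGraph 3) (criticalProbI 3) K
                              (openConn (0 : Site 3) ![(r : ℤ), 0, (r : ℤ)]) ω ∧
                            blockCondProb (zdGraph 3) (criticalProbI 3) K
                              (openConn (0 : Site 3) ![(r : ℤ), 0, (r : ℤ)]) ω ≤ 1 - κ})

/-- 7798's registered open stub S5' = the live line's `stub_boxRestriction`, verbatim. -/
def BoxRestriction : Prop :=
  ∃ c : ℝ, 0 < c ∧ ∃ r₀ : ℕ, ∀ r : ℕ, r₀ ≤ r →
    c * tau 3 (criticalProbI 3) 0 ![(r : ℤ), (r : ℤ), 0] ≤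
      P.real (openConnIn (lowerBox r) (0 : Site 3) ![(r : ℤ), (r : ℤ), 0])

/-- The live line's `stub_restrictedGluing`, verbatim up to the abbreviations above. -/
def RestrictedGluing : Prop :=
  ∃ c : ℝ, 0 < c ∧ ∃ r₀ : ℕ, ∀ r : ℕ, r₀ ≤ r →
    c * P.real (W r) ≤ P.real (W r ∩ openConn (0 : Site 3) ![(r : ℤ), 0, (r : ℤ)])

/-- **D6 glue** (provable by the lead's landed chain `stub_cruxOfCollar` with its step 3 — the closed shell —
replaced by the upper half of `CollarNonDegeneracy`): `Cov(A',B') ≥ ∫_{W ∩ {κ ≤ f ≤ 1−κ}} f(1−f) ≥ κ³ P(W) ≥ κ³c²τ²`.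
Recorded as a signature only (NOT filed: no leverage, see census §Decomposition D6). -/
def D6_glue : Prop :=
  BoxRestriction → CollarNonDegeneracy →
    Summit.CriticalPhenomena.PercolationContinuityZ3.Theses.PercTreeValue.TetrahedronHarrisGap

/-- **D5** (the lead's rev-7 split, glue LANDED p152490 `stub_cruxOfCollarByName`; NOT filed as `route edit --split`:
child 1 is stmt-0846, summit-sufficient by the PROVED assembly of route PercAnnulusCrossing — `skeleton.hides-summit`). -/
def D5_glue : Prop :=
  Summit.CriticalPhenomena.PercolationContinuityZ3.Theses.PercAnnulusCrossing.CritAnnulusNonCrossing →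
    BoxRestriction → RestrictedGluing →
      Summit.CriticalPhenomena.PercolationContinuityZ3.Theses.PercTreeValue.TetrahedronHarrisGap

/-- **N4 (negation, typed obstruction)**: the exact split `H = Ψ + d` with `d = H · P(0 ↮ b_r | A ∩ B)` shows
that if gluing given `A ∩ B` saturates (`P(0 ↮ b_r | 0↔a_r, b_r↔c_r) → 0`) then the crux is EQUIVALENT to the
sharp four-point excess `Ψ ≥ 1 + δ`; so every up-to-constants proof must lower-bound a NON-gluing probability.
`GluingSaturation` is the hypothesis of that obstruction (false-looking on ℤ³: MC `d/H ≈ 0.10` flat). -/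
def GluingSaturation : Prop :=
  Tendsto (fun r : ℕ =>
      P.real (openConn (0 : Site 3) ![(r : ℤ), (r : ℤ), 0] ∩
          openConn (![(r : ℤ), 0, (r : ℤ)] : Site 3) ![0, (r : ℤ), (r : ℤ)] ∩
          (openConn (0 : Site 3) ![(r : ℤ), 0, (r : ℤ)])ᶜ) /
        P.real (openConn (0 : Site 3) ![(r : ℤ), (r : ℤ), 0] ∩
          openConn (![(r : ℤ), 0, (r : ℤ)] : Site 3) ![0, (r : ℤ), (r : ℤ)]))
    atTop (nhds 0)

/-- **S⁺2 recalled** (four-point excess `Ψ ≥ 1+δ`, glue landed p127476 `crux_of_fourPointGap`). -/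
def FourPointExcess : Prop :=
  ∃ δ : ℝ, 0 < δ ∧ ∃ r₀ : ℕ, ∀ r : ℕ, r₀ ≤ r →
    (1 + δ) * tau 3 (criticalProbI 3) 0 ![(r : ℤ), (r : ℤ), 0] *
        tau 3 (criticalProbI 3) ![(r : ℤ), 0, (r : ℤ)] ![0, (r : ℤ), (r : ℤ)] ≤
      P.real (openConn (0 : Site 3) ![(r : ℤ), (r : ℤ), 0] ∩ openConn (0 : Site 3) ![(r : ℤ), 0, (r : ℤ)] ∩
        openConn (0 : Site 3) ![0, (r : ℤ), (r : ℤ)])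

/-- N4 as an implication to be read off `H = Ψ + d` (`measureReal_openConn_inter_eq_add`, landed p127476):
under gluing saturation the crux forces the sharp four-point excess. Signature only. -/
def N4_obstruction : Prop :=
  GluingSaturation →
    Summit.CriticalPhenomena.PercolationContinuityZ3.Theses.PercTreeValue.TetrahedronHarrisGap → FourPointExcess

/-- Middle block `Q_r`: the cube of radius `⌊r/8⌋` centred at the tetrahedron's centre `(⌊r/2⌋,⌊r/2⌋,⌊r/2⌋)`. -/
def midBox (r : ℕ) : Set (Site 3) :=
  {x : Site 3 | ∀ i : Fin 3, (r : ℤ) / 2 - (r : ℤ) / 8 ≤ x i ∧ x i ≤ (r : ℤ) / 2 + (r : ℤ) / 8}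

/-- Its one-step enlargement (vertices within sup-distance `⌊r/8⌋ + 1` of the centre). -/
def midBox' (r : ℕ) : Set (Site 3) :=
  {x : Site 3 | ∀ i : Fin 3, (r : ℤ) / 2 - (r : ℤ) / 8 - 1 ≤ x i ∧ x i ≤ (r : ℤ) / 2 + (r : ℤ) / 8 + 1}

/-- **S⁺6 `MidBlockKissing`** (the block-classification's third slot, typed): with the block the middle cube
`Q_r` (radius `⌊r/8⌋` around the tetrahedron's centre), the harvested term of the total-covariance identity needs the
BASELINE "both connections hold OFF `Q_r`, by clusters that are DISTINCT off `Q_r`, and both clusters reach the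
boundary layer of `Q_r`" at rate `≍ τ²` — disjoint coexistence with contact: the reverse-BK / bridge-mass class
(stmt-7798 / noise-line S1), not a new class. -/
def MidBlockKissing : Prop :=
  ∃ c : ℝ, 0 < c ∧ ∃ r₀ : ℕ, ∀ r : ℕ, r₀ ≤ r →
    c * (tau 3 (criticalProbI 3) 0 ![(r : ℤ), (r : ℤ), 0]) ^ 2 ≤
      P.real {ω | ω ∈ openConnIn (midBox r)ᶜ (0 : Site 3) ![(r : ℤ), (r : ℤ), 0] ∧
        ω ∈ openConnIn (midBox r)ᶜ (![(r : ℤ), 0, (r : ℤ)] : Site 3) ![0, (r : ℤ), (r : ℤ)] ∧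
        ω ∉ openConnIn (midBox r)ᶜ (0 : Site 3) ![(r : ℤ), 0, (r : ℤ)] ∧
        (∃ x ∈ midBox' r \ midBox r, ω ∈ openConnIn (midBox r)ᶜ (0 : Site 3) x) ∧
        (∃ y ∈ midBox' r \ midBox r, ω ∈ openConnIn (midBox r)ᶜ (![(r : ℤ), 0, (r : ℤ)] : Site 3) y)}

end Summit.CriticalPhenomena.PercolationContinuityZ3.Cruxes.TetrahedronHarrisGap.CensusS4

end
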